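import Literature.IUT.LogVolume.ExplicitEstimatesHeightsComparison
import HarnessLib

/-!
# [ExpEst] §1 "Heights" (Prop. 1.10 – Cor. 1.14): comparison with the Faltings height, linearization of
# logarithms, and the upper bounds for `h_non(j(E))` that feed Corollary 5.2 — PROVED at the number level

S. Mochizuki, I. Fesenko, Y. Hoshi, A. Minamide, W. Porowski, *Explicit estimates in inter-universal
Teichmüller theory*, Kodai Math. J. **45** (2022) 175–236 — [ExpEst], bib key `MochizukiEtAl2022`. §1, p. 193–196
(pdf p19.l6 – p22.l21 of the cell render `…/abc-iut/plan/repair/lit/renders/MFHMP-ExplicitEstimates-Kodai2022-book-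
anonnd-eeiutp`; journal page = pdf page + 174). CLASSICAL material ("[elementary and essentially well-known]",
Introduction p. 180), independent of inter-universal Teichmüller theory: nothing here is claim-tagged, nothing is
asserted about [IUTchIII] Cor. 3.12; no abc claim. Cell abc-iut, seat lit-abc-explicitiut (gen 4). Builds on
`ExplicitEstimatesHeights.lean` (Def. 1.1: `hNon`, `hArc`, `hTorArc`), `ExplicitEstimatesHeightsComparison.lean` (Def.
1.7 `hStorArc`; Prop. 1.8 (ii) `hStorArc_sub_hArc_jInv_bounds`; Prop. 1.9 (ii) `hArc_jInv_le`) and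
`ExplicitEstimatesCorollary52.lean` (Def. 1.13 at `Σ = 𝕍(ℚ)^arc`: `MemKArc`; `κ^log`: `kappaLog`), cited BY NAME. WHY:
Cor. 1.14 (ii)/(iii) is the input of step (P4) of the printed proof of [ExpEst] Cor. 5.2 (p. 215: "the existence of
an `l`-cyclic subgroup scheme of `E_F`, together with the fact that `l ≥ 10^15` …, would imply that `h ≤ κ^log`
(respectively, `h ≤ 5.12·10⁻¹³`) [cf. (P2); Remark 1.10.1; Corollary 1.14, (ii) (respectively, Corollary 1.14,
(iii))]") and the source of the constants `κ^log = 5·10⁻¹³ − 6.01·10⁻¹⁵·log(κ)` and `5.12·10⁻¹³` of Cor. 5.2.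

## Rendering (number level — what is and is not formalised)

THIS FILE is the NUMBER-LEVEL layer (real inequalities only; Mathlib analysis): the printed two-sided inequality
of **Prop. 1.10** is the predicate `Prop110Ineq H hFal` on the pair of reals `(h(j(E)), h_Fal(E))`, and it enters
Cor. 1.14 as HYPOTHESIS FIELDS of the datum `Cor114Data` (Prop. 1.10 for `E` and for `E_H := E/H`), together with
the two inputs of the printed proof of Cor. 1.14 (i) (p. 195–196): "`h_non(j(E_H)) = l·h_non(j(E))`" ([15] =
[GenEll], Lemma 3.5; where "`l` prime to the local heights" is used) and "`h_Fal(E_H) ≤ h_Fal(E) + (1/2)·log(l)`"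
([5] = Faltings, Lemma 5). Everything downstream — Lemma 1.11, Prop. 1.12, Cor. 1.14 (i), (ii), (iii) with all
printed constants — is PROVED here; no `Prop`-valued fact is introduced in this file (net debt 0). The
ELLIPTIC-CURVE layer is the companion `ExplicitEstimatesFaltingsComparisonEll.lean`: there `h_Fal` is the tree's
stable Faltings height `GenEll.EllPoint.htFalt = WeierstrassCurve.stableFaltingsHeight` `+ ½·log π` ([ExpEst] §0
"Curves"), Prop. 1.10 is a NAMED FACT (Löbrich 2017 [cite: Lobrich2017, Prop. 3.2]), and `Cor114Data` is
CONSTRUCTED from it with the tree's theorems (quotient isogeny, `𝔇_{j(E_H)} = 𝔇_{j(E)}^l`, Faltings' isogeny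
inequality `stableFaltingsHeight_le_of_isogeny_holds`). `h(j(E)) = h_non + h_arc` (Def. 1.1 (i)) is the pair
`(hNonE, hArcE)`; at the field level (§6) these are the tree's `hNon (Cor22.jInv λ)`, `hArc (Cor22.jInv λ)` for the
Legendre parameter `λ` of `E ≅ {y² = x(x−1)(x−λ)}` (Def. 1.7 is typed at the `λ`-level in
`ExplicitEstimatesHeightsComparison`). **Def. 1.13** for a
general `Σ ⊇ 𝕍(ℚ)^arc` is NOT typed: the printed proof of Cor. 1.14 (ii) uses `λ ∈ 𝒦_Σ(κ)` only at the archimedean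
places (p. 196), i.e. through `𝒦_Σ(κ) ⊆ 𝒦_{𝕍(ℚ)^arc}(κ)`; (ii) is typed under that archimedean condition (`MemKArc
κ`, the case `Σ = 𝕍(ℚ)^arc` of Cor. 5.2), which the printed hypothesis implies. "`ℚ(λ)` is mono-complex" in (iii)
is rendered, as in Prop. 1.9, by "`F ∋ λ` is mono-complex" (`IsMonoComplex F`; Remark 1.7.1 is not formalised). The
primality of `l` plays no role at the number level; `l : ℕ`, `≥ 10^15` where print assumes so.

Locators (pdf = journal − 174): Prop. 1.10 p19.l6–14 ↦ `Prop110Ineq` · Rmk 1.10.1 ↦ (already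
`ExpEst.logQForall_eq_hNon`) · Lemma 1.11 p19.l26–32 ↦ `lemma111`, `lemma111'` · Prop. 1.12 p19.l33 – p20.l9 ↦ `C112`,
`prop112` · Def. 1.13 p20.l21–40 ↦ (`MemKArc`) · Cor. 1.14 p20.l46 – p21.l40: (i) ↦ `cor114_i`, `cor114_i'`; (ii) ↦
`cor114_ii_display`, `cor114_ii_le_kappaLog`, `hStorArc_le_of_memKArc`, `hNon_jInv_le_kappaLog`;
(iii) ↦ `cor114_iii_display`, `cor114_iii_le`, `hNon_jInv_le_of_isMonoComplex` · proof p21.l41 –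
p22.l21 · printed numerical estimates p21.l22–24, l37–40 ↦ §4.
-/

noncomputable section

open scoped Classical

namespace Literature.IUT.LogVolume

namespace ExpEst

open NumberField Real Cor22 Literature.NumberTheory.DiophantineGeometry.GenEll

/-! ## 1. Lemma 1.11 (Linearization of logarithms), p. 193 -/

/-- **[ExpEst] Lemma 1.11**, first display: "Let `a ∈ ℝ_{>0}` be a positive real number. Then we have
`0 ≤ a − log(a) − 1`." [cite: MochizukiEtAl2022, Lemma 1.11 p. 193] -/
theorem lemma111 {a : ℝ} (ha : 0 < a) : 0 ≤ a - Real.log a - 1 := by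
  have := Real.log_le_sub_one_of_pos ha
  linarith

/-- **[ExpEst] Lemma 1.11**, second display: "In particular, [by taking “`a`” to be `a·(1 + x)`] we have
`log(1 + x) − a·x ≤ a − log(a) − 1` for all nonnegative real `x ∈ ℝ_{≥0}`." (Proof as printed: the first
display at `a·(1+x)`, and `log(a·(1+x)) = log(a) + log(1+x)`.) [cite: MochizukiEtAl2022, Lemma 1.11 p. 193] -/
theorem lemma111' {a : ℝ} (ha : 0 < a) {x : ℝ} (hx : 0 ≤ x) :
    Real.log (1 + x) - a * x ≤ a - Real.log a - 1 := by
  have h1 : 0 < 1 + x := by linarith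
  have h := Real.log_le_sub_one_of_pos (mul_pos ha h1)
  rw [Real.log_mul ha.ne' h1.ne'] at h
  linarith

/-! ## 2. Proposition 1.10 (shape) and Proposition 1.12, p. 193–194 -/

/-- **[ExpEst] Proposition 1.10** (Comparison between `h(j(E))` and `h_Fal(E)`, I), the printed conclusion as a
predicate on the pair of reals `(H, hFal) = (h(j(E)), h_Fal(E))`: "`0 ≤ (1/12)·h(j(E)) − h_Fal(E) ≤ (1/2)·log(1 +
h(j(E))) + 2.071`" — for "`F` a number field; `E` an elliptic curve over `F` that has semi-stable reduction over
`O_F`" ("This follows immediately from [10], Proposition 3.1" = Löbrich, *A gap in the spectrum of the Faltings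
height*, JTNB 29 (2017)). This predicate is the hypothesis consumed by Prop. 1.12 / Cor. 1.14 at the number level;
the statement over the tree's stable Faltings height is the named fact of the companion `…FaltingsComparisonEll`
file. [cite: MochizukiEtAl2022, Prop 1.10 p. 193] -/
def Prop110Ineq (H hFal : ℝ) : Prop :=
  0 ≤ H / 12 - hFal ∧ H / 12 - hFal ≤ 1 / 2 * Real.log (1 + H) + 2.071

/-- **[ExpEst] Proposition 1.12**, the constant: "Let `x ∈ ℝ_{>0}` be a positive real number. Write `C(x) :=
(1/2)·( x/(6(1+x)) − log(x/(6(1+x))) − 1 ) + 2.071`." [cite: MochizukiEtAl2022, Prop 1.12 p. 193] -/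
def C112 (x : ℝ) : ℝ :=
  1 / 2 * (x / (6 * (1 + x)) - Real.log (x / (6 * (1 + x))) - 1) + 2.071

/-- **[ExpEst] Proposition 1.12** (Comparison between `h(j(E))` and `h_Fal(E)`, II): "in the notation of
Proposition 1.10, we have `(1/(12(1+x)))·h(j(E)) − h_Fal(E) ≤ C(x)`" — PROVED from the conclusion of Prop. 1.10 for
`(H, hFal) = (h(j(E)), h_Fal(E))` (`H ≥ 0`, Def. 1.1 (i)) exactly as printed (p. 194): "where the first (respectively,
second) inequality follows from Proposition 1.10 (respectively, Lemma 1.11, where we take “`a`” to be `x/(6(1+x))`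
and “`x`” to be `h(j(E))`)". [cite: MochizukiEtAl2022, Prop 1.12 p. 193–194] -/
theorem prop112 {x : ℝ} (hx : 0 < x) {H hFal : ℝ} (hH : 0 ≤ H) (h : Prop110Ineq H hFal) :
    H / (12 * (1 + x)) - hFal ≤ C112 x := by
  have hx1 : 0 < 1 + x := by linarith
  have ha : 0 < x / (6 * (1 + x)) := by positivity
  have h111 := lemma111' ha hH
  have key : H / (12 * (1 + x)) - hFal = (H / 12 - hFal) - 1 / 2 * (x / (6 * (1 + x)) * H) := by
    field_simp
    ring
  rw [key]
  unfold C112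
  linarith [h.2, h111]

/-! ## 3. Corollary 1.14 (Upper bounds for `h_non(j(E))`) at the number level, p. 194–196 -/

/-- The number-level datum of **[ExpEst] Corollary 1.14** for an elliptic curve `E` over a number field (semi-
stable over `O_F`), a prime `l`, an `l`-cyclic subgroup scheme `H ⊆ E` with `l` prime to the local heights of `E`
at its places of bad multiplicative reduction, and `E_H := E/H` (proof of (i), p. 195): indexed by `hNonE =
h_non(j(E))`, `hArcE = h_arc(j(E))` and `l`, it carries `h_Fal(E)` and the three heights of `E_H` as real numbers,
with the PRINTED INPUTS as hypothesis fields — Prop. 1.10 for `E` and for `E_H` ("`E_H` is isogenous to `E`, hence has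
semi-stable reduction at all `v ∈ 𝕍(F)^non`"), "`h_non(j(E_H)) = l·h_non(j(E))` [cf. [15], Lemma 3.5; also Remark
1.10.1]" and "`h_Fal(E_H) ≤ h_Fal(E) + (1/2)·log(l)` [[5], Lemma 5]" — and `h_arc ≥ 0` (Def. 1.1 (i)). Constructed
at the elliptic-curve level in the companion `…FaltingsComparisonEll` file. [cite: MochizukiEtAl2022, Cor 1.14 proof p. 195–196] -/
structure Cor114Data (hNonE hArcE : ℝ) (l : ℕ) where
  /-- `h_Fal(E)`, the Faltings height of `E` in [ExpEst]'s normalisation (§0: `+ ½·log π`), as a real number. -/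
  hFalE : ℝ
  /-- `h_non(j(E_H))`. -/
  hNonEH : ℝ
  /-- `h_arc(j(E_H))`. -/
  hArcEH : ℝ
  /-- `h_Fal(E_H)`. -/
  hFalEH : ℝ
  /-- `h_arc(j(E_H)) ≥ 0` (Def. 1.1 (i): "`h_arc(α) := … (≥ 0)`"). -/
  hArcEH_nonneg : 0 ≤ hArcEH
  /-- Prop. 1.10 for `E`: `0 ≤ (1/12)·h(j(E)) − h_Fal(E) ≤ (1/2)·log(1 + h(j(E))) + 2.071`. -/
  prop110_E : Prop110Ineq (hNonE + hArcE) hFalE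
  /-- Prop. 1.10 for `E_H` (isogenous to `E`, hence semi-stable). -/
  prop110_EH : Prop110Ineq (hNonEH + hArcEH) hFalEH
  /-- "`h_non(j(E_H)) = l·h_non(j(E))`" (p. 196, first display; [15], Lemma 3.5). -/
  hNon_isog : hNonEH = l * hNonE
  /-- "`h_Fal(E_H) ≤ h_Fal(E) + (1/2)·log(l)`" (p. 196, second display; [5], Lemma 5). -/
  hFal_isog : hFalEH ≤ hFalE + 1 / 2 * Real.log l

variable {hNonE hArcE : ℝ} {l : ℕ}

/-- **[ExpEst] Corollary 1.14 (i)**, first display: "`(l/(12(1+x)))·h_non(j(E)) ≤ h_Fal(E) + (1/2)·log(l) + C(x)`" —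
PROVED as printed (p. 195–196): Prop. 1.12 for `E_H`, `h(j(E_H)) ≥ h_non(j(E_H)) = l·h_non(j(E))`, and `h_Fal(E_H) ≤
h_Fal(E) + (1/2)·log(l)`. [cite: MochizukiEtAl2022, Cor 1.14 (i) p. 194] -/
theorem cor114_i (D : Cor114Data hNonE hArcE l) (hn : 0 ≤ hNonE) {x : ℝ} (hx : 0 < x) :
    (l : ℝ) / (12 * (1 + x)) * hNonE ≤ D.hFalE + 1 / 2 * Real.log l + C112 x := by
  have hx1 : 0 < 1 + x := by linarith
  have hq : 0 < (12 * (1 + x))⁻¹ := by positivity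
  have hHn : 0 ≤ D.hNonEH := by rw [D.hNon_isog]; positivity
  have h112 := prop112 hx (add_nonneg hHn D.hArcEH_nonneg) D.prop110_EH
  have e1 : (l : ℝ) / (12 * (1 + x)) * hNonE = (12 * (1 + x))⁻¹ * D.hNonEH := by
    rw [D.hNon_isog]; ring
  have e2 : (D.hNonEH + D.hArcEH) / (12 * (1 + x)) =
      (12 * (1 + x))⁻¹ * D.hNonEH + (12 * (1 + x))⁻¹ * D.hArcEH := by ring
  have e3 : 0 ≤ (12 * (1 + x))⁻¹ * D.hArcEH := mul_nonneg hq.le D.hArcEH_nonneg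
  rw [e1]
  linarith [h112, e2, e3, D.hFal_isog]

/-- **[ExpEst] Corollary 1.14 (i)**, second display: "In particular, by applying the first inequality of
Proposition 1.10, we obtain that `((l − (1+x))/(12(1+x)))·h_non(j(E)) ≤ (1/12)·h_arc(j(E)) + (1/2)·log(l) + C(x)`".
[cite: MochizukiEtAl2022, Cor 1.14 (i) p. 194] -/
theorem cor114_i' (D : Cor114Data hNonE hArcE l) (hn : 0 ≤ hNonE) {x : ℝ} (hx : 0 < x) :
    ((l : ℝ) - (1 + x)) / (12 * (1 + x)) * hNonE ≤ 1 / 12 * hArcE + 1 / 2 * Real.log l + C112 x := by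
  have hx1 : 0 < 1 + x := by linarith
  have e : ((l : ℝ) - (1 + x)) / (12 * (1 + x)) * hNonE =
      (l : ℝ) / (12 * (1 + x)) * hNonE - hNonE / 12 := by
    field_simp
  rw [e]
  have h1 := cor114_i D hn hx
  have h2 := D.prop110_E.1
  linarith

/-- **[ExpEst] Corollary 1.14 (ii)**, first display, number level: if "`h_arc(j(E)) − 11·log(2) ≤ h^{𝔖-tor}_arc(E)
≤ … = log(κ⁻³)`" (the two displays of the printed proof, p. 196 — here the hypothesis `harc`; DERIVED at the field
level in `hArc_jInv_le_of_memKArc`), then "`((l − (1+x))/(12(1+x)))·h_non(j(E)) ≤ (1/2)·log(l) + C(x) − (1/4)·log(κ)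
+ (11/12)·log(2)`". [cite: MochizukiEtAl2022, Cor 1.14 (ii) p. 195] -/
theorem cor114_ii_display (D : Cor114Data hNonE hArcE l) (hn : 0 ≤ hNonE) {x : ℝ} (hx : 0 < x) {κ : ℝ}
    (harc : hArcE ≤ 11 * Real.log 2 - 3 * Real.log κ) :
    ((l : ℝ) - (1 + x)) / (12 * (1 + x)) * hNonE ≤
      1 / 2 * Real.log l + C112 x - 1 / 4 * Real.log κ + 11 / 12 * Real.log 2 := by
  have h := cor114_i' D hn hx
  linarith

/-- **[ExpEst] Corollary 1.14 (iii)**, first display, number level: if `h_arc(j(E)) ≤ h_non(j(E)) + 19·log 2`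
(Prop. 1.9 (ii) for mono-complex `ℚ(λ)` — here the hypothesis `h19`; the tree's `hArc_jInv_le`), then "`((l −
2(1+x))/(12(1+x)))·h_non(j(E)) ≤ (1/2)·log(l) + C(x) + (19/12)·log(2)`". [cite: MochizukiEtAl2022, Cor 1.14 (iii) p. 195] -/
theorem cor114_iii_display (D : Cor114Data hNonE hArcE l) (hn : 0 ≤ hNonE) {x : ℝ} (hx : 0 < x)
    (h19 : hArcE ≤ hNonE + 19 * Real.log 2) :
    ((l : ℝ) - 2 * (1 + x)) / (12 * (1 + x)) * hNonE ≤
      1 / 2 * Real.log l + C112 x + 19 / 12 * Real.log 2 := by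
  have hx1 : 0 < 1 + x := by linarith
  have h := cor114_i' D hn hx
  have e : ((l : ℝ) - 2 * (1 + x)) / (12 * (1 + x)) * hNonE =
      ((l : ℝ) - (1 + x)) / (12 * (1 + x)) * hNonE - hNonE / 12 := by
    field_simp
    ring
  rw [e]
  linarith

/-! ## 4. The printed numerical estimates (p. 195), PROVED -/

/-- `log(3/2) ≤ 133/324 (= 0.41049…)`: the series `−log(1 − x) = Σ x^{i+1}/(i+1)` at `x = 1/3` truncated after
four terms (Mathlib `Real.abs_log_sub_add_sum_range_le`). Auxiliary numerics. [folklore] -/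
private theorem log_three_halves_le : Real.log (3 / 2) ≤ 133 / 324 := by
  have hx : |(1 / 3 : ℝ)| < 1 := by rw [abs_of_pos (by norm_num)]; norm_num
  have h := Real.abs_log_sub_add_sum_range_le hx 4
  rw [abs_of_pos (show (0 : ℝ) < 1 / 3 by norm_num)] at h
  norm_num [Finset.sum_range_succ] at h
  have h2 : Real.log (2 / 3) = -Real.log (3 / 2) := by
    rw [← Real.log_inv]; norm_num
  rw [h2] at h
  have h3 := (abs_le.mp h).1
  linarith

/-- "`C(1) ≤ 2.86`" (p. 195; `C(1) = (1/2)·(1/12 + log 12 − 1) + 2.071 = 2.855…`, via `log 12 = 3·log 2 + log(3/2)`,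
Mathlib's `Real.log_two_lt_d9` and `log_three_halves_le`). [cite: MochizukiEtAl2022, Cor 1.14 (ii) p. 195] -/
theorem C112_one_le : C112 1 ≤ 2.86 := by
  unfold C112
  have e : Real.log (1 / (6 * (1 + 1)) : ℝ) = -(3 * Real.log 2 + Real.log (3 / 2)) := by
    rw [show (1 / (6 * (1 + 1)) : ℝ) = (2 ^ 3 * (3 / 2) : ℝ)⁻¹ by norm_num, Real.log_inv,
      Real.log_mul (by norm_num) (by norm_num), Real.log_pow]
    push_cast
    ring
  rw [e]
  have h2 := Real.log_two_lt_d9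
  have h3 := log_three_halves_le
  norm_num at h2 ⊢
  linarith

/-- Tangent-line bound at `2^50 (≈ 1.13·10^15)`: `log(t) ≤ 50·log(2) − 1 + t/2^50` (`log(t/2^50) ≤ t/2^50 − 1`), and
hence, for `t ≥ 10^15`, "`log(l)/(l−4) ≤ 3.46·10⁻¹⁴`" (p. 195; a fortiori "`log(l)/(l−2) ≤ 3.46·10⁻¹⁴`"), in the
cleared form. [cite: MochizukiEtAl2022, Cor 1.14 (ii)(iii) p. 195] -/
theorem log_le_of_ge_ten_pow_fifteen {t : ℝ} (ht : (10 : ℝ) ^ 15 ≤ t) :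
    Real.log t ≤ 3.46 / 10 ^ 14 * (t - 4) := by
  have ht0 : 0 < t := lt_of_lt_of_le (by positivity) ht
  have h2' : (0 : ℝ) < 1125899906842624 := by norm_num
  have h := Real.log_le_sub_one_of_pos (div_pos ht0 h2')
  rw [Real.log_div ht0.ne' h2'.ne', show (1125899906842624 : ℝ) = 2 ^ 50 by norm_num, Real.log_pow] at h
  push_cast at h
  have h2 := Real.log_two_lt_d9
  norm_num at h2 ht ⊢
  nlinarith

/-! ## 5. Corollary 1.14 (ii), (iii) for `l ≥ 10^15`, `x = 1`: the constants `κ^log` and `5.12·10⁻¹³` -/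

/-- **[ExpEst] Corollary 1.14 (ii)**, conclusion: for `l ≥ 10^15` and `0 < κ ≤ 1`, "`h_non(j(E)) ≤ … ≤
(24/(l−2))·((1/2)·log(l) + 2.86 − (1/4)·log(κ) + 0.64) ≤ 5·10⁻¹³ − 6.01·10⁻¹⁵·log(κ)`" `= κ^log` (the tree's
`ExpEst.kappaLog κ`, Cor. 5.2 p. 211) — "where we apply the estimates `log(l)/(l−2) ≤ 3.46·10⁻¹⁴`, `6/(l−2) ≤
6.01·10⁻¹⁵`, `(11/12)·log(2) ≤ 0.64`, and `C(1) ≤ 2.86`" (`log_le_of_ge_ten_pow_fifteen`, `C112_one_le`; the other two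
inline from `Real.log_two_lt_d9`). Field level: `hNon_jInv_le_kappaLog`. [cite: MochizukiEtAl2022, Cor 1.14 (ii) p. 195] -/
theorem cor114_ii_le_kappaLog (D : Cor114Data hNonE hArcE l) (hn : 0 ≤ hNonE) (hl : (10 : ℝ) ^ 15 ≤ l)
    {κ : ℝ} (hκ0 : 0 < κ) (hκ1 : κ ≤ 1) (harc : hArcE ≤ 11 * Real.log 2 - 3 * Real.log κ) :
    hNonE ≤ kappaLog κ := by
  have hl' : (10 : ℝ) ^ 15 ≤ l := hl
  have hl2 : (0 : ℝ) < (l : ℝ) - 2 := by norm_num at hl'; linarith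
  have h := cor114_ii_display D hn one_pos harc
  rw [show ((l : ℝ) - (1 + 1)) / (12 * (1 + 1)) * hNonE = hNonE * ((l : ℝ) - 2) / 24 by ring,
    div_le_iff₀ (by norm_num : (0 : ℝ) < 24)] at h
  have hlog := log_le_of_ge_ten_pow_fifteen hl'
  have hC := C112_one_le
  have h2 := Real.log_two_lt_d9
  have hκ : Real.log κ ≤ 0 := Real.log_nonpos hκ0.le hκ1
  -- the `κ`-free part and the `κ`-part separately
  have hA : 12 * Real.log l + 24 * C112 1 + 22 * Real.log 2 ≤ 5 / 10 ^ 13 * ((l : ℝ) - 2) := by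
    norm_num at hlog hC h2 hl' ⊢
    nlinarith
  have hB : -(6 * Real.log κ) ≤ -(6.01 / 10 ^ 15 * ((l : ℝ) - 2) * Real.log κ) := by
    have h1 : 0 ≤ 6.01 / 10 ^ 15 * ((l : ℝ) - 2) - 6 := by norm_num at hl' ⊢; linarith
    nlinarith [mul_nonneg h1 (neg_nonneg.mpr hκ)]
  have hmain : hNonE * ((l : ℝ) - 2) ≤ kappaLog κ * ((l : ℝ) - 2) := by
    unfold kappaLog
    nlinarith
  exact le_of_mul_le_mul_right hmain hl2

/-- **[ExpEst] Corollary 1.14 (iii)**, conclusion: for `l ≥ 10^15`, "`h_non(j(E)) ≤ … ≤ (24/(l−4))·((1/2)·log(l) +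
2.86 + 1.1) ≤ 4.16·10⁻¹³ + 0.96·10⁻¹³ = 5.12·10⁻¹³` — where we apply the estimates `log(l)/(l−4) ≤ 3.46·10⁻¹⁴`,
`24/(l−4) ≤ 2.41·10⁻¹⁴`, `(19/12)·log(2) ≤ 1.1`, and `C(1) ≤ 2.86`" (number level, hypothesis `h19` = Prop. 1.9
(ii); field level: `hNon_jInv_le_of_isMonoComplex`). [cite: MochizukiEtAl2022, Cor 1.14 (iii) p. 195] -/
theorem cor114_iii_le (D : Cor114Data hNonE hArcE l) (hn : 0 ≤ hNonE) (hl : (10 : ℝ) ^ 15 ≤ l)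
    (h19 : hArcE ≤ hNonE + 19 * Real.log 2) : hNonE ≤ 5.12 / 10 ^ 13 := by
  have hl' : (10 : ℝ) ^ 15 ≤ l := hl
  have hl4 : (0 : ℝ) < (l : ℝ) - 4 := by norm_num at hl'; linarith
  have h := cor114_iii_display D hn one_pos h19
  rw [show ((l : ℝ) - 2 * (1 + 1)) / (12 * (1 + 1)) * hNonE = hNonE * ((l : ℝ) - 4) / 24 by ring,
    div_le_iff₀ (by norm_num : (0 : ℝ) < 24)] at h
  have hlog := log_le_of_ge_ten_pow_fifteen hl'
  have hC := C112_one_le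
  have h2 := Real.log_two_lt_d9
  have hmain : hNonE * ((l : ℝ) - 4) ≤ 5.12 / 10 ^ 13 * ((l : ℝ) - 4) := by
    norm_num at hlog hC h2 hl' h ⊢
    nlinarith
  exact le_of_mul_le_mul_right hmain hl4

/-! ## 6. Field level: `λ ∈ 𝒦_{𝕍(ℚ)^arc}(κ)` and mono-complex base fields (proof of Cor. 1.14 (ii), p. 196) -/

section FieldLevel

variable {F : Type*} [Field F] [NumberField F]

/-- One toric archimedean height under two-sided archimedean bounds: if `κ ≤ |α|_w` and `κ ≤ |α|_w⁻¹` at every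
archimedean place `w` (`κ > 0`), then `h^tor_arc(α) ≤ −(1/2)·log κ` ("`max{‖λ‖_v, ‖λ‖_v⁻¹} ≤ κ⁻¹` … `≤ (1/[ℚ(λ):ℚ])·
Σ_{v ∈ 𝕍(ℚ(λ))^arc} [ℚ(λ)_v : ℝ]·log(…)`", proof of Cor. 1.14 (ii), p. 196 — one summand of `h^{𝔖-tor}_arc`).
[cite: MochizukiEtAl2022, Cor 1.14 (ii) proof p. 196] -/
theorem hTorArc_le_of_bounds {κ : ℝ} (hκ : 0 < κ) (α : F)
    (h : ∀ w : InfinitePlace F, κ ≤ w α ∧ κ ≤ (w α)⁻¹) :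
    hTorArc α ≤ -(1 / 2 * Real.log κ) := by
  have hd : (0 : ℝ) < Module.finrank ℚ F := by exact_mod_cast Module.finrank_pos
  have hsum : ∑ w : InfinitePlace F, (w.mult : ℝ) = Module.finrank ℚ F := by
    exact_mod_cast InfinitePlace.sum_mult_eq (K := F)
  have hle : ∑ w : InfinitePlace F, (w.mult : ℝ) * Real.log (max (w α) (w α)⁻¹) ≤
      ∑ w : InfinitePlace F, (w.mult : ℝ) * (-Real.log κ) := by
    refine Finset.sum_le_sum fun w _ => mul_le_mul_of_nonneg_left ?_ (Nat.cast_nonneg _)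
    obtain ⟨h1, h2⟩ := h w
    have hα : 0 < w α := lt_of_lt_of_le hκ h1
    have hmax : max (w α) (w α)⁻¹ ≤ κ⁻¹ := max_le ((le_inv_comm₀ hκ hα).mp h2) (inv_anti₀ hκ h1)
    calc Real.log (max (w α) (w α)⁻¹) ≤ Real.log κ⁻¹ := Real.log_le_log (lt_max_of_lt_left hα) hmax
      _ = -Real.log κ := Real.log_inv κ
  unfold hTorArc
  calc (2 * (Module.finrank ℚ F : ℝ))⁻¹ *
        ∑ w : InfinitePlace F, (w.mult : ℝ) * Real.log (max (w α) (w α)⁻¹)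
      ≤ (2 * (Module.finrank ℚ F : ℝ))⁻¹ * ∑ w : InfinitePlace F, (w.mult : ℝ) * (-Real.log κ) :=
        mul_le_mul_of_nonneg_left hle (by positivity)
    _ = -(1 / 2 * Real.log κ) := by
        rw [← Finset.sum_mul, hsum]
        field_simp

/-- **Proof of Cor. 1.14 (ii), archimedean step** (p. 196): if `λ ∈ 𝒦_{𝕍(ℚ)^arc}(κ)` — membership typed by the tree's
`ExpEst.MemKArc κ` (Def. 1.13 at `Σ = 𝕍(ℚ)^arc`: all six `‖a(λ)‖_w ≥ κ`, `a ∈ A`, at every archimedean `w`) — then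
"`h^{𝔖-tor}_arc(E) ≤ (1/[ℚ(λ):ℚ])·Σ_{v ∈ 𝕍(ℚ(λ))^arc} [ℚ(λ)_v : ℝ]·log(κ⁻³) = log(κ⁻³)`" `= −3·log κ` (computed over
the presenting field `F ∋ λ`; the orbit representatives `λ, 1−λ, λ(λ−1)⁻¹` of `hStorArc_eq`).
[cite: MochizukiEtAl2022, Cor 1.14 (ii) proof p. 196] -/
theorem hStorArc_le_of_memKArc {κ : ℝ} (hκ : 0 < κ) (P : NFPoint) (hK : MemKArc κ P) :
    hStorArc P.x ≤ -(3 * Real.log κ) := by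
  have hx : ∀ w : InfinitePlace P.F, κ ≤ w P.x ∧ κ ≤ (w P.x)⁻¹ := by
    intro w
    obtain ⟨h1, h2, -, -, -, -⟩ := hK w.embedding
    rw [norm_inv] at h2
    rw [InfinitePlace.norm_embedding_eq] at h1 h2
    exact ⟨h1, h2⟩
  have h1x : ∀ w : InfinitePlace P.F, κ ≤ w (1 - P.x) ∧ κ ≤ (w (1 - P.x))⁻¹ := by
    intro w
    obtain ⟨-, -, h3, h4, -, -⟩ := hK w.embedding
    rw [norm_inv] at h4
    rw [← map_one w.embedding, ← map_sub, InfinitePlace.norm_embedding_eq] at h3 h4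
    exact ⟨h3, h4⟩
  have hq : ∀ w : InfinitePlace P.F, κ ≤ w (P.x / (P.x - 1)) ∧ κ ≤ (w (P.x / (P.x - 1)))⁻¹ := by
    intro w
    obtain ⟨-, -, -, -, h5, h6⟩ := hK w.embedding
    have e5 : w.embedding P.x * (w.embedding P.x - 1)⁻¹ = w.embedding (P.x / (P.x - 1)) := by
      rw [map_div₀, map_sub, map_one, div_eq_mul_inv]
    have e6 : (w.embedding P.x - 1) * (w.embedding P.x)⁻¹ = (w.embedding (P.x / (P.x - 1)))⁻¹ := by
      rw [map_div₀, map_sub, map_one, inv_div, div_eq_mul_inv]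
    rw [e5, InfinitePlace.norm_embedding_eq] at h5
    rw [e6, norm_inv, InfinitePlace.norm_embedding_eq] at h6
    exact ⟨h5, h6⟩
  have b1 := hTorArc_le_of_bounds hκ P.x hx
  have b2 := hTorArc_le_of_bounds hκ (1 - P.x) h1x
  have b3 := hTorArc_le_of_bounds hκ (P.x / (P.x - 1)) hq
  rw [hStorArc_eq]
  linarith

/-- The hypothesis `harc` of the number-level statements, DERIVED: for `λ ∈ 𝒦_{𝕍(ℚ)^arc}(κ)` (`λ ∉ {0,1}`),
`h_arc(j(E)) ≤ 11·log 2 − 3·log κ` ("we conclude from Proposition 1.8, (ii), that `h_arc(j(E)) − 11·log(2) ≤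
h^{𝔖-tor}_arc(E) ≤ … = log(κ⁻³)`", p. 196; Prop. 1.8 (ii) is `hStorArc_sub_hArc_jInv_bounds`).
[cite: MochizukiEtAl2022, Cor 1.14 (ii) proof p. 196] -/
theorem hArc_jInv_le_of_memKArc {κ : ℝ} (hκ : 0 < κ) (P : NFPoint) (hU : P.InU) (hK : MemKArc κ P) :
    hArc (jInv P.x) ≤ 11 * Real.log 2 - 3 * Real.log κ := by
  have h8 := (hStorArc_sub_hArc_jInv_bounds P.x hU.1 hU.2).1
  have hS := hStorArc_le_of_memKArc hκ P hK
  linarith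

/-- **[ExpEst] Corollary 1.14 (ii)** at the field level: for a point `λ ∈ 𝒦_{𝕍(ℚ)^arc}(κ)` of `ℙ¹ ∖ {0,1,∞}` (`0 <
κ ≤ 1`, Def. 1.13), `E ≅ {y² = x(x−1)(x−λ)}`, `l ≥ 10^15`, and the inputs of Cor. 1.14 (an `l`-cyclic subgroup scheme
with `l` prime to the local heights: `Cor114Data` for `(h_non(j(E)), h_arc(j(E))) = (hNon (jInv λ), hArc (jInv λ))`):
"`h_non(j(E)) ≤ 5·10⁻¹³ − 6.01·10⁻¹⁵·log(κ)`" `= κ^log` (`ExpEst.kappaLog κ`) — the form consumed by step (P4) of the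
proof of Cor. 5.2 (p. 215). [cite: MochizukiEtAl2022, Cor 1.14 (ii) p. 195] -/
theorem hNon_jInv_le_kappaLog {κ : ℝ} (hκ0 : 0 < κ) (hκ1 : κ ≤ 1) (P : NFPoint) (hU : P.InU)
    (hK : MemKArc κ P) {l : ℕ} (hl : (10 : ℝ) ^ 15 ≤ l)
    (D : Cor114Data (hNon (jInv P.x)) (hArc (jInv P.x)) l) :
    hNon (jInv P.x) ≤ kappaLog κ :=
  cor114_ii_le_kappaLog D (hNon_nonneg _) hl hκ0 hκ1 (hArc_jInv_le_of_memKArc hκ0 P hU hK)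

/-- **[ExpEst] Corollary 1.14 (iii)** at the field level: "Suppose that `ℚ(λ)` is mono-complex" (rendered `F ∋ λ`
mono-complex, `IsMonoComplex F`, as in Prop. 1.9), `λ ∉ {0,1}`, `l ≥ 10^15`, and the inputs of Cor. 1.14
(`Cor114Data` for `(hNon (jInv λ), hArc (jInv λ))`): "`h_non(j(E)) ≤ 5.12·10⁻¹³`" — via Prop. 1.9 (ii) `hArc_jInv_le`;
the form consumed by step (P4) of the proof of Cor. 5.2 in the mono-complex case (p. 215).
[cite: MochizukiEtAl2022, Cor 1.14 (iii) p. 195] -/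
theorem hNon_jInv_le_of_isMonoComplex (hF : IsMonoComplex F) (t : F) (h0 : t ≠ 0) (h1 : t ≠ 1)
    {l : ℕ} (hl : (10 : ℝ) ^ 15 ≤ l) (D : Cor114Data (hNon (jInv t)) (hArc (jInv t)) l) :
    hNon (jInv t) ≤ 5.12 / 10 ^ 13 :=
  cor114_iii_le D (hNon_nonneg _) hl (hArc_jInv_le hF t h0 h1)

end FieldLevel

end ExpEst

end Literature.IUT.LogVolume

end
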